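import Literature.NumberTheory.EllipticCurves.ModularParametrizationCongruenceHondaProofs
import Literature.NumberTheory.EllipticCurves.IsogenyFrobeniusTraceHoldsProofs
import HarnessLib

/-!
# `IsNewformOf.exists_maninConstant_ne_zero` holds

Topic `NumberTheory/EllipticCurves`; a proofs-only sibling of `ModularParametrizationDegree.lean`
(theorems only; no definition, no named fact). It discharges the named fact
`Literature.NumberTheory.EllipticCurves.ModularForms.IsNewformOf.exists_maninConstant_ne_zero`
(Breuil–Conrad–Diamond–Taylor 2001, p. 845: "(2) ⇒ (6) follows from a construction of Shimura
[Sh2] and a theorem of Faltings [Fa1]"): for an elliptic curve `W/ℚ`, its newform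
`f ∈ S₂(Γ₀(N))` (`IsNewformOf W f`) and any Néron-type period pair `L` of `W`, there is a non-zero
integer `c` with `c·Λ_f ⊆ Λ_L` (`Λ_f` the period lattice of `2πif(τ)dτ`).

The two printed inputs are now theorems of the tree:

* *the construction of Shimura* — `E_f = ℂ/Λ_f` is an elliptic curve over `ℚ` with Néron lattice
  `Λ_f` (`PeriodLatticeRationalityUnconditionalProofs`) whose `a_p` agree with those of `f` for
  almost all `p` — the Eichler–Shimura congruence, proved for the newform of `W` by Honda's
  formal-group method (`ModularParametrizationCongruenceHondaProofs`:
  `IsNewformOf.finite_setOf_cuspCoeff_ne_lFunction_shortModel`, assembled into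
  `IsNewformOf.exists_maninConstant_ne_zero_of_faltings`);
* *the theorem of Faltings* — `WeierstrassCurve.isIsogenous_iff_frobeniusTrace_eq_holds`
  (`IsogenyFrobeniusTraceHoldsProofs`, along Bost's proof via André's algebraicity criterion).

## References

* C. Breuil, B. Conrad, F. Diamond, R. Taylor, *On the modularity of elliptic curves over `ℚ`:
  wild 3-adic exercises*, J. Amer. Math. Soc. 14 (2001), p. 845, "(2) ⇒ (6)" (held:
  `doi-10-1090-s0894-0347-01-00370-8`, PDF p. 4, read). [BCDTJAMS2001]
* G. Shimura, *Introduction to the arithmetic theory of automorphic functions* (1971), Thm. 7.14,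
  Thm. 7.15. [ShimuraIATAF1971]
* G. Faltings, Invent. Math. 73 (1983), §5 Korollar 2. [Faltings1983Endlichkeit]
* T. Honda, J. Math. Soc. Japan 22 (1970), §6.2. [Honda1970]
-/

namespace Literature.NumberTheory.EllipticCurves.ModularForms

/-- **`IsNewformOf.exists_maninConstant_ne_zero` holds** (Breuil–Conrad–Diamond–Taylor 2001,
p. 845, "(2) ⇒ (6) follows from a construction of Shimura and a theorem of Faltings"): for an
elliptic curve `W/ℚ` with newform `f ∈ S₂(Γ₀(N))` and any Néron-type period pair `L` of `W`, some
non-zero integer `c` has `c·Λ_f ⊆ Λ_L`. Proof: `IsNewformOf.exists_maninConstant_ne_zero_of_faltings`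
(Shimura's construction with the Eichler–Shimura congruence for `ℂ/Λ_f` by Honda's method) fed
with Faltings' isogeny theorem `WeierstrassCurve.isIsogenous_iff_frobeniusTrace_eq_holds`.
[cite: BCDTJAMS2001, p. 845, "(2) ⇒ (6)"] [cite: ShimuraIATAF1971, Thm. 7.14 and Thm. 7.15]
[cite: Faltings1983Endlichkeit, §5 Korollar 2 (i) ⟺ (iii)] -/
theorem IsNewformOf.exists_maninConstant_ne_zero_holds : IsNewformOf.exists_maninConstant_ne_zero :=
  IsNewformOf.exists_maninConstant_ne_zero_of_faltings
    WeierstrassCurve.isIsogenous_iff_frobeniusTrace_eq_holds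

end Literature.NumberTheory.EllipticCurves.ModularForms
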